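import Literature.NumberTheory.LFunctions.WeilOddThetaVector
import Literature.NumberTheory.LFunctions.WeilMarkovQuadratic

/-!
# Route OddSector, crux `OddBartaFloor`: the window image of the odd theta vector (definitions)

Definition file of line `Sketch` of crux item stmt-RiemannHypothesis-17779 (`OddBartaFloor`, route
`RiemannHypothesis/OddSector`). Normalisation of `Literature/NumberTheory/LFunctions/WeilExplicit.lean`
(additive variable `t = log x`, `W = weilFunctional = polar − prime + arch`) and of
`WeilOddThetaVector.lean` (`Φ′ = weilThetaPhiDeriv`, odd theta vector
`H_a = weilOddThetaVector a = 𝟙_{[−a,a]}·(−Φ′)`), `w = weilArchDensity` (`e^{r/2}/(2 sinh r)`).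

For a smooth test `g` supported in the window `[−a, a]`, the polarised Weil functional against the
BV probe `H_a` is `W(g ⋆ H̃_a) = ∫ g(t) T_a(t) dt` with the WINDOW IMAGE

  `T_a(t) = 2ϖ_a sinh(t/2) + Σ_n Λ(n) n^{-1/2} (R_a(t − log n) + R_a(t + log n)) + ∫ R_a(s) w(|t − s|) ds`,

where `R_a = −Φ′ − H_a = 𝟙_{|s|>a}·(−Φ′)` is the ODD TAIL and `ϖ_a = ∫_{s>a} (−Φ′(s))·2 sinh(s/2) ds` its
polar weight: `Φ′` is a null vector of Weil's form (`(Φ′)^(s) = −(s − ½)ξ(s)`,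
`weilMellin_weilThetaPhiDeriv`), so only the off-diagonal image of the tail survives (polar rank-one
piece, prime translates, archimedean coupling through Bombieri's kernel). The identity is proved along
the truncations `H_b − H_a` (`b → ∞`), whence the truncated objects below. This file only DEFINES the
objects (2001 programme, route `odd-sector-eigenfunction-sign`, results §§2–4: the decomposition
`A_aH_a = 𝒫 + S − D + 𝒜`; internal, unpublished); all properties are proved in the sibling
`OddSectorOddBartaFloor*.lean` files.
-/

-- `Summit.RiemannHypothesis.RiemannHypothesis.…` repeats the summit name by design (D-0017 layout).
set_option linter.dupNamespace false

noncomputable section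

open Set MeasureTheory
open scoped Real ArithmeticFunction.vonMangoldt

namespace Summit.RiemannHypothesis.RiemannHypothesis.Theorems.OddBartaFloor

open Literature.NumberTheory.LFunctions

/-- The ODD TAIL `R_a := −Φ′ − H_a`, i.e. `R_a(s) = −Φ′(s)` for `|s| > a` and `0` on the window
`[−a, a]` (so that `H_a = −Φ′ − R_a`, the window truncation of the null vector `−Φ′`). Odd; `≥ 0` on
`(a, ∞)` since `Φ′ < 0` there. -/
def oddThetaTail (a : ℝ) (s : ℝ) : ℝ :=
  -weilThetaPhiDeriv s - weilOddThetaVector a s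

/-- The TRUNCATED odd tail `R_{a,b} := H_b − H_a`, i.e. for `a ≤ b`: `R_{a,b}(s) = −Φ′(s)` for
`a < |s| ≤ b` and `0` elsewhere (a bounded, compactly supported, odd function). -/
def oddThetaTailTrunc (a b : ℝ) (s : ℝ) : ℝ :=
  weilOddThetaVector b s - weilOddThetaVector a s

/-- The POLAR WEIGHT of the tail, `ϖ_a := ∫_{s > a} (−Φ′(s)) · 2 sinh(s/2) ds` (`= −R̂_a(0) = R̂_a(1)`
for the Mellin–Laplace transform `R̂ = weilMellin` of the odd tail). -/
def oddThetaPolarWeight (a : ℝ) : ℝ :=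
  ∫ s in Ioi a, (-weilThetaPhiDeriv s) * (2 * Real.sinh (s / 2))

/-- The truncated polar weight `ϖ_{a,b} := ∫_{a < s ≤ b} (−Φ′(s)) · 2 sinh(s/2) ds`. -/
def oddThetaPolarWeightTrunc (a b : ℝ) : ℝ :=
  ∫ s in Ioc a b, (-weilThetaPhiDeriv s) * (2 * Real.sinh (s / 2))

/-- The PRIME LAYER of the window image: `Σ_n Λ(n) n^{-1/2} (R_a(t − log n) + R_a(t + log n))`
(for `t ∈ (0, a)`: the right-tail translates `R_a(t + log n) ≥ 0` minus the wrong-sign layer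
`−R_a(t − log n) = |Φ′(log n − t)| 𝟙_{log n > a + t}`). -/
def oddThetaPrimeLayer (a : ℝ) (t : ℝ) : ℝ :=
  ∑' n : ℕ, (Λ n : ℝ) / Real.sqrt n * (oddThetaTail a (t - Real.log n) + oddThetaTail a (t + Real.log n))

/-- The truncated prime layer (same with `R_{a,b}`; a finitely supported sum). -/
def oddThetaPrimeLayerTrunc (a b : ℝ) (t : ℝ) : ℝ :=
  ∑' n : ℕ, (Λ n : ℝ) / Real.sqrt n *
    (oddThetaTailTrunc a b (t - Real.log n) + oddThetaTailTrunc a b (t + Real.log n))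

/-- The ARCHIMEDEAN LAYER of the window image: `∫ R_a(s) w(|t − s|) ds`, `w = weilArchDensity`
(for `t ∈ (0,a)`: `= ∫_{s>a} (−Φ′(s)) (w(s − t) − w(s + t)) ds ≥ 0`; logarithmically singular as
`t → ±a`). A real Bochner integral. -/
def oddThetaArchLayer (a : ℝ) (t : ℝ) : ℝ :=
  ∫ s, oddThetaTail a s * weilArchDensity |t - s|

/-- The truncated archimedean layer (same with `R_{a,b}`). -/
def oddThetaArchLayerTrunc (a b : ℝ) (t : ℝ) : ℝ :=
  ∫ s, oddThetaTailTrunc a b s * weilArchDensity |t - s|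

/-- The WINDOW IMAGE `T_a(t) = 2ϖ_a sinh(t/2) + (prime layer) + (archimedean layer)` of the odd theta
vector: `W(g ⋆ H̃_a) = ∫ g T_a` for window tests `g` (2001 results §3, `A_aH_a` on `(−a, a)`). -/
def oddThetaImage (a : ℝ) (t : ℝ) : ℝ :=
  2 * oddThetaPolarWeight a * Real.sinh (t / 2) + oddThetaPrimeLayer a t + oddThetaArchLayer a t

/-- The truncated window image `T_{a,b}`: `W(g ⋆ (H_b − H_a)~) = −∫ g T_{a,b}` for window tests `g`
and `a ≤ b`, and `T_{a,b} → T_a` on the window as `b → ∞`. -/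
def oddThetaImageTrunc (a b : ℝ) (t : ℝ) : ℝ :=
  2 * oddThetaPolarWeightTrunc a b * Real.sinh (t / 2) + oddThetaPrimeLayerTrunc a b t +
    oddThetaArchLayerTrunc a b t

/-- Unfolding: `R_a = −Φ′ − H_a`. -/
theorem oddThetaTail_def (a s : ℝ) :
    oddThetaTail a s = -weilThetaPhiDeriv s - weilOddThetaVector a s := rfl

/-- Unfolding: `R_{a,b} = H_b − H_a`. -/
theorem oddThetaTailTrunc_def (a b s : ℝ) :
    oddThetaTailTrunc a b s = weilOddThetaVector b s - weilOddThetaVector a s := rfl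

/-- Unfolding: `T_a = 2ϖ_a sinh(·/2) + primeLayer + archLayer`. -/
theorem oddThetaImage_def (a t : ℝ) :
    oddThetaImage a t =
      2 * oddThetaPolarWeight a * Real.sinh (t / 2) + oddThetaPrimeLayer a t + oddThetaArchLayer a t := rfl

/-- Unfolding: `T_{a,b} = 2ϖ_{a,b} sinh(·/2) + primeLayerTrunc + archLayerTrunc`. -/
theorem oddThetaImageTrunc_def (a b t : ℝ) :
    oddThetaImageTrunc a b t =
      2 * oddThetaPolarWeightTrunc a b * Real.sinh (t / 2) + oddThetaPrimeLayerTrunc a b t +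
        oddThetaArchLayerTrunc a b t := rfl

end Summit.RiemannHypothesis.RiemannHypothesis.Theorems.OddBartaFloor

end
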